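import Literature.AlgebraicGeometry.HodgeTheory.StablyNondegenerateHodgeLieSymplectic
import Literature.AlgebraicGeometry.HodgeTheory.RealMultiplicationHodgeLieAlgebra
import Literature.AlgebraicGeometry.Motives.HodgeStructureCMSeparableAveraging
import HarnessLib

/-!
# The Lie algebra of the Hodge group of a stably nondegenerate complex abelian variety whose endomorphism algebra is a totally real field `F` is `𝔰𝔭_F(H¹, ψ)`, and its complexification is the full block-symplectic algebra `⊕_τ 𝔰𝔭(V_τ)` (Milne 1999 Prop. 4.8 (a) ⇒ (c) with `S(A) = R_{F/ℚ} Sp`; Moonen–Zarhin (1.8))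

HONEST FRAMING (programme `pub-hodge-ring2`, verbatim): «research route conditional on HC_CM; not a corollary;
Q11.4-sentence-2 already refuted in dim ≥ 3». For THIS file: step (F2) of the Literature lane's route R55 («anything (D) ×
(stably nondegenerate with real multiplication by a totally real field)»); its content is UNCONDITIONAL (theorems only, no
new named fact, nothing depends on `HC_CM`; the inputs are the tree theorems `exists_isReal_hodgeModel_holds`-style
hypotheses `hHD`, `hI` supplied by callers), it is not a corollary of the Hodge conjecture and does not touch Q11.4.

WHAT IS PRINTED. Milne, Prop. 4.8 (p. 660): for an abelian variety `A` over `ℂ` the following are equivalent: «(a) no power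
of `A` supports an exotic Hodge class; … (c) `Hg′(A) = S(A)`», where (§1 p. 644) «`S(A)` is the largest algebraic subgroup of
`Sp(e_D)` whose elements commute with the endomorphisms of `A`» — for `End⁰(A) = F` a totally real field, `S(A)` is the
centraliser `R_{F/ℚ} Sp_F(H¹, ψ_F)` of `F` in `Sp(H¹, ψ)`, with Lie algebra `𝔰𝔭_F(H¹, ψ) = {X F-linear, ψ-skew}` and
complexification `⊕_{τ : F → ℂ} 𝔰𝔭(V_τ)` on the joint eigenspaces `V_τ` of `F` (Hazama 1983 §3: `H¹ ⊗ ℂ = ⊕ V_i`).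
Moonen–Zarhin (1.8): «`Hg(X) = Sp_D(V, φ)` ⟺ … `D(Xⁿ) = B(Xⁿ)` for all `n`» (type I–III; here `D = F`).

WHAT IS PROVED HERE (the tree's `StablyNondegenerateHodgeLieSymplectic` — the case `End⁰(A) = ℚ` — generalized to a
totally real field `F = End⁰(A)`):

* §1 (abstract, namespace `Motives.HodgeStructure`; a polarized Hodge structure of odd weight with an action `A` of a number
  field `E` by `ψ`-self-adjoint operators): the `E`-TRANSVECTIONS `e·N_v = average A A (ψ(v, ·) v)` (DeMeyer–Ingraham's
  separability-idempotent averaging of the rank-one `N_v`; `= ψ_E(v, ·) v`) are `E`-linear (`isEquivariant_average`),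
  square-zero (`EndAction.average_smulRight_self_mul_self`: the `E`-line `E v` is `ψ`-isotropic) and `ψ`-skew
  (`EndAction.average_smulRight_self_skew`, via the SYMMETRY of the separability idempotent,
  `EndAction.sum_apply_traceDualBasis_symm`), and they SPAN `𝔰𝔭_E(V, ψ)`:
  `Polarization.mem_of_isEquivariant_of_skew_of_forall_average_mem` (average the expansion of
  `Polarization.mem_of_skew_of_forall_smulRight_mem`). `Polarization.mem_spanC_of_commute_of_skew`: descent of
  «commutes with `End_Hdg ⊗ ℂ` and `ψ_ℂ`-skew» to the complex span of the rational such operators.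
* §2 `mem_unitaryCentralizerGroup_of_forall_form_eq_of_forall_comp_eq`: for ANY complex abelian variety `A` of positive
  dimension, a `ψ`-symplectic automorphism of `H¹(A(ℂ); ℚ)` commuting with `End_Hdg(H¹)` lies, complexified and transported
  to `H¹(A(ℂ); ℂ)`, in Milne's `S(A)(ℂ) = unitaryCentralizerGroup A D.Hη` (the tree's `End⁰ = ℚ` bridge
  `mem_unitaryCentralizerGroup_of_forall_form_eq` with the scalar step replaced by commutation with the comparison Hodge
  endomorphism `a`, `ψ(a·, ·) ∝ Q_h`).
* §3 THE THEOREMS, for `A` stably nondegenerate of positive dimension with `End⁰(A) = F` a totally real field and ANY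
  polarization `ψ` of `H¹(A(ℂ); ℚ)`: `mem_hodgeLie_of_commute_of_skew_of_isStablyNondegenerate_of_isField`
  (`𝔰𝔭_F(H¹, ψ) ⊆ Lie Hg(H¹A)`), `mem_hodgeLie_iff_commute_and_skew_of_isStablyNondegenerate_of_isField`
  (`Lie Hg(H¹A) = 𝔰𝔭_F(H¹, ψ)`), `mem_hodgeLieC_of_commute_of_skew_of_isStablyNondegenerate_of_isField` and the block form
  `mem_hodgeLieC_of_mapsTo_of_skew_of_isStablyNondegenerate_of_isField` (`Lie Hg(H¹A) ⊗ ℂ ⊇ ⊕_τ 𝔰𝔭(V_τ)`: the hypothesis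
  (RIGID BLOCKS) `hrigid` of `Motives/HodgeThetaAnnihilatorTimesRigidBlocks`, with `τ ↦ hodgeCharacter hF hHD hI τ` and
  `isInternal_eigenBlock_hodgeCharacter`).

No hypothesis on `[F : ℚ]` or on the relative dimension `dim A / [F : ℚ]` (for relative dimension one the conclusion is the
tree's unconditional `mem_hodgeLieC_hodge_one_iff_mapsTo_of_isTotallyReal`, Hazama/Ribet, without (D)).

## References

* [Milne1999LefschetzClasses] J. S. Milne, Duke Math. J. 96 (1999), §1 p. 644, Thm. 4.4, Prop. 4.8 (p. 660).
  [cite: Milne1999LefschetzClasses, Prop. 4.8 (p. 660)]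
* [MoonenZarhin1999LowDim] B. Moonen, Yu. G. Zarhin, Math. Ann. 315 (1999), §1 (1.8), §2 (2.1)–(2.4).
  [cite: MoonenZarhin1999LowDim, §1 (1.8)]
* [DeMeyerIngraham1971] F. DeMeyer, E. Ingraham, LNM 181 (1971), Ch. III §2 Thm. 2.1. [cite: DeMeyerIngraham1971, Ch. III §2 Thm. 2.1]
* [GoodmanWallachGTM255] R. Goodman, N. R. Wallach, GTM 255 (2009), §1.1.1 and Thm. 2.2.2. [cite: GoodmanWallachGTM255, Thm. 2.2.2]
* [Hazama1983] F. Hazama, Tôhoku Math. J. 35 (1983), §3 pp. 305–306. [cite: Hazama1983, §3 (pp. 305–306)]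
* [Deligne1982HodgeCycles] P. Deligne, LNM 900 (1982), I §3 Prop. 3.4. [cite: Deligne1982HodgeCycles, I §3 Prop. 3.4]
-/

noncomputable section

open scoped TensorProduct
open CategoryTheory Module NumberField

/-! ### §1 The `F`-symplectic Lie algebra `𝔰𝔭_F(V, ψ)` of a polarized odd-weight Hodge structure with an action of a
number field `F` by `ψ`-self-adjoint operators is spanned by its `F`-transvections -/

namespace Literature.AlgebraicGeometry.Motives.HodgeStructure

universe u

section SpF

variable {V : Type u} [AddCommGroup V] [Module ℚ V] {n : ℤ} {H : HodgeStructure V n}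
  {E : Type*} [Field E] [NumberField E] {ι : Type*} [Fintype ι] [DecidableEq ι]

/-- **The separability idempotent of a number field is symmetric**: `Σᵢ Φ(bᵢ, bᵢ^∨) = Σᵢ Φ(bᵢ^∨, bᵢ)` for every
`ℚ`-bilinear `Φ` (the trace form is symmetric, so the trace-dual basis of `b^∨` is `b`, Mathlib's
`Module.Basis.traceDual_traceDual`, and the idempotent does not depend on the basis,
`sum_apply_traceDualBasis_eq`; "`Σⱼ xⱼ ⊗ yⱼ = Σᵢ yᵢ ⊗ xᵢ`"). [cite: DeMeyerIngraham1971, Ch. III §2 Thm. 2.1 (proof)] -/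
theorem EndAction.sum_apply_traceDualBasis_symm {M : Type*} [AddCommGroup M] [Module ℚ M]
    (Φ : E →ₗ[ℚ] E →ₗ[ℚ] M) (b : Basis ι ℚ E) :
    ∑ i, Φ (b i) (EndAction.traceDualBasis b i) = ∑ i, Φ (EndAction.traceDualBasis b i) (b i) := by
  have hbb : EndAction.traceDualBasis (EndAction.traceDualBasis b) = b := Module.Basis.traceDual_traceDual b
  have h := EndAction.sum_apply_traceDualBasis_eq Φ b (EndAction.traceDualBasis b)
  rw [hbb] at h
  exact h

variable (ψ : Polarization H)

/-- `ψ(v, a v) = 0` for a `ψ`-self-adjoint `a` in odd weight (`ψ(v, av) = ψ(av, v) = -ψ(v, av)`).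
[cite: GoodmanWallachGTM255, §1.1.1] -/
theorem Polarization.form_self_apply_eq_zero_of_isAdjointPair (hn : Odd n) {a : Module.End ℚ V}
    (ha : LinearMap.IsAdjointPair ψ.form ψ.form a a) (v : V) : ψ.form v (a v) = 0 := by
  have hswap : ∀ v w, ψ.form w v = -ψ.form v w := fun v w => by
    rw [ψ.form_swap, Int.negOnePow_odd n hn]; simp
  have h1 : ψ.form (a v) v = ψ.form v (a v) := ha v v
  have h2 := hswap v (a v)
  linarith

variable (A : EndAction H E)

/-- **The `F`-transvection `e·N_v`** (the average `Σᵢ ι(bᵢ) N_v ι(bᵢ^∨)` of the rank-one `N_v = ψ(v, ·) v`), evaluated: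
`(e·N_v)(x) = ι(Σᵢ ψ(v, ι(bᵢ^∨) x) bᵢ) v` — it is `ψ_F(v, x) v` for the `F`-bilinear form `ψ_F` with `Tr_{F/ℚ} ψ_F = ψ`.
[cite: DeMeyerIngraham1971, Ch. II §2 Prop. 2.3 (proof)] [cite: GoodmanWallachGTM255, §1.1.1] -/
theorem EndAction.average_smulRight_self_apply (b : Basis ι ℚ E) (v x : V) :
    EndAction.average A A ((ψ.form v).smulRight v) x =
      A.ι (∑ i, ψ.form v (A.ι (EndAction.traceDualBasis b i) x) • b i) v := by
  rw [EndAction.average_apply A A b, map_sum, LinearMap.sum_apply]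
  refine Finset.sum_congr rfl fun i _ => ?_
  rw [LinearMap.smulRight_apply, map_smul, map_smul, LinearMap.smul_apply]

/-- The `F`-transvection `e·N_v` kills the `F`-line `F v` when `F` acts by `ψ`-self-adjoint operators (`F v` is
`ψ`-isotropic: `ψ(v, f v) = 0`). [cite: GoodmanWallachGTM255, §1.1.1] [cite: Hazama1983, §3 (pp. 305–306)] -/
theorem EndAction.average_smulRight_self_apply_ι (hn : Odd n)
    (hself : ∀ e : E, LinearMap.IsAdjointPair ψ.form ψ.form (A.ι e) (A.ι e)) (v : V) (e : E) :
    EndAction.average A A ((ψ.form v).smulRight v) (A.ι e v) = 0 := by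
  classical
  rw [EndAction.average_smulRight_self_apply ψ A (Module.finBasis ℚ E)]
  have h0 : ∀ i, ψ.form v (A.ι (EndAction.traceDualBasis (Module.finBasis ℚ E) i) (A.ι e v)) = 0 := fun i => by
    rw [← Module.End.mul_apply, ← map_mul]
    exact ψ.form_self_apply_eq_zero_of_isAdjointPair hn (hself _) v
  simp only [h0, zero_smul, Finset.sum_const_zero, map_zero, LinearMap.zero_apply]

/-- **`(e·N_v)² = 0`**: the `F`-transvection is a square-zero operator (its image is the isotropic `F`-line `F v`).
[cite: GoodmanWallachGTM255, §1.1.1 and Thm. 2.2.2] -/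
theorem EndAction.average_smulRight_self_mul_self (hn : Odd n)
    (hself : ∀ e : E, LinearMap.IsAdjointPair ψ.form ψ.form (A.ι e) (A.ι e)) (v : V) :
    EndAction.average A A ((ψ.form v).smulRight v) * EndAction.average A A ((ψ.form v).smulRight v) = 0 := by
  classical
  refine LinearMap.ext fun x => ?_
  rw [Module.End.mul_apply, EndAction.average_smulRight_self_apply ψ A (Module.finBasis ℚ E) v x,
    EndAction.average_smulRight_self_apply_ι ψ A hn hself, LinearMap.zero_apply]

/-- **`e·N_v` is `ψ`-skew** (the `ι(b)` are self-adjoint, `N_v` is skew, and the separability idempotent is symmetric).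
[cite: GoodmanWallachGTM255, §1.1.1] [cite: DeMeyerIngraham1971, Ch. III §2 Thm. 2.1 (proof)] -/
theorem EndAction.average_smulRight_self_skew (hn : Odd n)
    (hself : ∀ e : E, LinearMap.IsAdjointPair ψ.form ψ.form (A.ι e) (A.ι e)) (v x y : V) :
    ψ.form (EndAction.average A A ((ψ.form v).smulRight v) x) y +
      ψ.form x (EndAction.average A A ((ψ.form v).smulRight v) y) = 0 := by
  classical
  set b := Module.finBasis ℚ E with hb
  have hswap : ∀ v w, ψ.form w v = -ψ.form v w := fun v w => by
    rw [ψ.form_swap, Int.negOnePow_odd n hn]; simp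
  have h1 : ∀ i, ψ.form (A.ι (b i) v) y = ψ.form v (A.ι (b i) y) := fun i => hself (b i) v y
  have h2 : ∀ i, ψ.form x (A.ι (b i) v) = -ψ.form v (A.ι (b i) x) := fun i => by
    rw [← hself (b i) x v]; exact hswap v _
  rw [EndAction.average_apply A A b, EndAction.average_apply A A b]
  simp only [LinearMap.smulRight_apply, map_smul, map_sum, LinearMap.sum_apply, LinearMap.smul_apply, smul_eq_mul,
    h1, h2]
  set Φ : E →ₗ[ℚ] E →ₗ[ℚ] ℚ := (LinearMap.mul ℚ ℚ).compl₁₂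
    (ψ.form v ∘ₗ LinearMap.applyₗ x ∘ₗ A.ι.toLinearMap) (ψ.form v ∘ₗ LinearMap.applyₗ y ∘ₗ A.ι.toLinearMap) with hΦ
  have hΦapply : ∀ a a', Φ a a' = ψ.form v (A.ι a x) * ψ.form v (A.ι a' y) := fun a a' => rfl
  have hsym := EndAction.sum_apply_traceDualBasis_symm Φ b
  simp only [hΦapply] at hsym
  rw [← hsym, ← Finset.sum_add_distrib]
  exact Finset.sum_eq_zero fun i _ => by ring

/-- **`𝔰𝔭_F(V, ψ)` is spanned by the `F`-transvections `e·N_v`**: a `ℚ`-subspace `L ⊆ End_ℚ(V)` containing every `e·N_v`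
contains every `F`-LINEAR `ψ`-skew `Y` — apply the averaging projector `e·` (`ℚ`-linear, the identity on `F`-linear maps,
`average_eq_self_of_isEquivariant`) to the expansion `Y = ½ Σᵢ (N_{fᵢ + Y eᵢ} − N_{fᵢ} − N_{Y eᵢ})` of
`Polarization.mem_of_skew_of_forall_smulRight_mem`. [cite: GoodmanWallachGTM255, Thm. 2.2.2 and §1.1.1]
[cite: DeMeyerIngraham1971, Ch. II §2 Prop. 2.3 (proof)] -/
theorem Polarization.mem_of_isEquivariant_of_skew_of_forall_average_mem [Module.Finite ℚ V] (hn : Odd n)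
    (L : Submodule ℚ (Module.End ℚ V)) (hL : ∀ v : V, EndAction.average A A ((ψ.form v).smulRight v) ∈ L)
    {Y : Module.End ℚ V} (hYeq : EndAction.IsEquivariant A A Y) (hY : ∀ v w, ψ.form (Y v) w + ψ.form v (Y w) = 0) :
    Y ∈ L := by
  have h := ψ.mem_of_skew_of_forall_smulRight_mem hn (L.comap (EndAction.average A A)) (fun v => hL v) hY
  rw [Submodule.mem_comap, EndAction.average_eq_self_of_isEquivariant hYeq] at h
  exact h

/-- **Descent of commutants with skewness**: a `ℂ`-linear operator of `V ⊗ ℂ` commuting with `End_Hdg(V) ⊗ ℂ` and skew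
for `ψ ⊗ ℂ` lies in the complex span of every rational subspace `𝔤` containing all RATIONAL operators commuting with
`End_Hdg(V)` and skew for `ψ` (both families of conditions are rational linear conditions;
`mem_spanC_iInf_ker_of_forall_eq_zero`). [cite: Deligne1982HodgeCycles, I §3 (proof of Prop. 3.4)] -/
theorem Polarization.mem_spanC_of_commute_of_skew [Module.Finite ℚ V] (𝔤 : Submodule ℚ (Module.End ℚ V))
    (h𝔤 : ∀ X : Module.End ℚ V, (∀ a : H.endAlg, X * (a : Module.End ℚ V) = (a : Module.End ℚ V) * X) →
      (∀ v w, ψ.form (X v) w + ψ.form v (X w) = 0) → X ∈ 𝔤)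
    {Y : Module.End ℂ (ℂ ⊗[ℚ] V)}
    (hcomm : ∀ a : H.endAlg, Y * (a : Module.End ℚ V).baseChange ℂ = (a : Module.End ℚ V).baseChange ℂ * Y)
    (hskew : ∀ x y, ψ.form.baseChange ℂ (Y x) y + ψ.form.baseChange ℂ x (Y y) = 0) : Y ∈ spanC 𝔤 := by
  set p : (V × V) ⊕ (H.endAlg × V × V) → (Module.End ℚ V →ₗ[ℚ] ℚ) :=
    Sum.elim (fun d => ψ.form.flip d.2 ∘ₗ LinearMap.applyₗ d.1 + ψ.form d.1 ∘ₗ LinearMap.applyₗ d.2)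
      (fun d => ψ.form.flip d.2.2 ∘ₗ LinearMap.applyₗ ((d.1 : Module.End ℚ V) d.2.1) -
        (ψ.form.flip d.2.2 ∘ₗ (d.1 : Module.End ℚ V)) ∘ₗ LinearMap.applyₗ d.2.1) with hp
  set P : (V × V) ⊕ (H.endAlg × V × V) → (Module.End ℂ (ℂ ⊗[ℚ] V) →ₗ[ℂ] ℂ) :=
    Sum.elim (fun d => (ψ.form.baseChange ℂ).flip (ofRat d.2) ∘ₗ LinearMap.applyₗ (ofRat d.1) +
        ψ.form.baseChange ℂ (ofRat d.1) ∘ₗ LinearMap.applyₗ (ofRat d.2))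
      (fun d => (ψ.form.baseChange ℂ).flip (ofRat d.2.2) ∘ₗ
          LinearMap.applyₗ ((d.1 : Module.End ℚ V).baseChange ℂ (ofRat d.2.1)) -
        ((ψ.form.baseChange ℂ).flip (ofRat d.2.2) ∘ₗ (d.1 : Module.End ℚ V).baseChange ℂ) ∘ₗ
          LinearMap.applyₗ (ofRat d.2.1)) with hP
  have hp₁ : ∀ (d : V × V) X, p (Sum.inl d) X = ψ.form (X d.1) d.2 + ψ.form d.1 (X d.2) := fun d X => rfl
  have hp₂ : ∀ (d : H.endAlg × V × V) X, p (Sum.inr d) X =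
      ψ.form (X ((d.1 : Module.End ℚ V) d.2.1)) d.2.2 - ψ.form ((d.1 : Module.End ℚ V) (X d.2.1)) d.2.2 := fun d X => rfl
  have hP₁ : ∀ (d : V × V) Z, P (Sum.inl d) Z = ψ.form.baseChange ℂ (Z (ofRat d.1)) (ofRat d.2) +
      ψ.form.baseChange ℂ (ofRat d.1) (Z (ofRat d.2)) := fun d Z => rfl
  have hP₂ : ∀ (d : H.endAlg × V × V) Z, P (Sum.inr d) Z =
      ψ.form.baseChange ℂ (Z ((d.1 : Module.End ℚ V).baseChange ℂ (ofRat d.2.1))) (ofRat d.2.2) -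
        ψ.form.baseChange ℂ ((d.1 : Module.End ℚ V).baseChange ℂ (Z (ofRat d.2.1))) (ofRat d.2.2) := fun d Z => rfl
  have hmem : Y ∈ spanC (⨅ d, LinearMap.ker (p d)) := by
    refine mem_spanC_iInf_ker_of_forall_eq_zero p P (fun d X => ?_) (fun d => ?_)
    · rcases d with d | d
      · rw [hP₁, hp₁, ofRat_apply, ofRat_apply, LinearMap.baseChange_tmul, LinearMap.baseChange_tmul,
          LinearMap.BilinForm.baseChange_tmul, LinearMap.BilinForm.baseChange_tmul, mul_one, map_add,
          Algebra.algebraMap_eq_smul_one, Algebra.algebraMap_eq_smul_one]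
      · rw [hP₂, hp₂, ofRat_apply, ofRat_apply, LinearMap.baseChange_tmul, LinearMap.baseChange_tmul,
          LinearMap.baseChange_tmul, LinearMap.baseChange_tmul, LinearMap.BilinForm.baseChange_tmul,
          LinearMap.BilinForm.baseChange_tmul, mul_one, map_sub, Algebra.algebraMap_eq_smul_one,
          Algebra.algebraMap_eq_smul_one]
    · rcases d with d | d
      · rw [hP₁]; exact hskew _ _
      · rw [hP₂, ← Module.End.mul_apply, hcomm d.1, Module.End.mul_apply, sub_self]
  have hle : (⨅ d, LinearMap.ker (p d) : Submodule ℚ (Module.End ℚ V)) ≤ 𝔤 := by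
    intro X hX
    have hX' : ∀ d, p d X = 0 := fun d => by
      have h := (Submodule.mem_iInf _).1 hX d
      rwa [LinearMap.mem_ker] at h
    refine h𝔤 X (fun a => ?_) (fun v w => ?_)
    · refine LinearMap.ext fun v => ?_
      rw [Module.End.mul_apply, Module.End.mul_apply, ← sub_eq_zero]
      refine ψ.nondegenerate.1 _ fun w => ?_
      rw [map_sub, LinearMap.sub_apply]
      have h := hX' (Sum.inr (a, v, w))
      rwa [hp₂] at h
    · have h := hX' (Sum.inl (v, w))
      rwa [hp₁] at h
  exact spanC_mono hle hmem

end SpF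

end Literature.AlgebraicGeometry.Motives.HodgeStructure

/-! ### §2 Milne's `S(A)(ℂ)` contains the `ψ`-symplectic automorphisms of `H¹(A;ℚ)` commuting with `End_Hdg(H¹)` -/

namespace Literature.AlgebraicGeometry.HodgeTheory

open Literature.AlgebraicTopology.SingularHomology
open Literature.AlgebraicGeometry.Motives (IsSmoothProjective AbelianVariety bettiCohomology ComplexPoints
  ofRatClassBaseChange ofRatClassBaseChange_tmul HodgeTensorFacts hodgeTensorFacts_holds)
open Literature.Barriers.HodgeConjecture
open Literature.AlgebraicGeometry.Motives.HodgeStructure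
open Literature.AlgebraicGeometry.Milne1999
open Literature.AlgebraicGeometry.ComplexMultiplication

section Bridge

variable {A : AbelianVariety ℂ}

open Literature.AlgebraicGeometry.VanGeemen1994 (pullbackOne hodgeClassSpan)
open Literature.Geometry.Kaehler (lefschetzPow)

/-- `(q • a) ⊗ 1 = q · (a ⊗ 1)` for the rational lattice map `Hᵏ(Y; ℚ) → Hᵏ(Y; ℂ)`. [folklore] -/
private theorem ofRatClass_rat_smul_trf {Y : Type} [TopologicalSpace Y] (k : ℕ) (q : ℚ) (a : singularCohomology ℚ ℚ Y k) :
    ofRatClass Y k (q • a) = (q : ℂ) • ofRatClass Y k a := by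
  rw [← ofRatClassBaseChange_ofRat, ← ofRatClassBaseChange_ofRat, Motives.HodgeStructure.ofRat_apply,
    Motives.HodgeStructure.ofRat_apply, TensorProduct.tmul_smul, ← algebraMap_smul ℂ q ((1 : ℂ) ⊗ₜ[ℚ] a), map_smul,
    eq_ratCast]

/-- **Every `ψ`-symplectic automorphism of `H¹(A(ℂ); ℚ)` commuting with the Hodge endomorphisms lies in Milne's
`S(A)(ℂ)`** (`S(A)` = «the largest algebraic subgroup of `Sp(e_D)` whose elements commute with the endomorphisms of `A`»,
§1 p. 644), for ANY complex abelian variety `A` of positive dimension, any polarization `ψ` of the Hodge structure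
`H¹(A(ℂ); ℚ)` and any Kähler–rational datum `D` (`h = η ⊗ 1`): its complexification, transported to `H¹(A(ℂ); ℂ)`,
commutes with every `φ^*` (the rational `φ^*` are Hodge endomorphisms, `BettiUniverse.pull_hodge`) and preserves Milne's
pairing `Q_h(x, y) = h^{g-1} ⌣ x ⌣ y` — PROOF as in the tree's `mem_unitaryCentralizerGroup_of_forall_form_eq` (the case
`End⁰(A) = ℚ`): `Q_h` is, up to a non-zero scalar, the complexification of the RATIONAL form `B(v, w) = ψ(a v, w)` with
`a = ψ♭⁻¹ ∘ B♭` a HODGE endomorphism (`F¹` is `Q_h`-isotropic by type and `ψ_ℂ`-Lagrangian), and `u` commutes with `a`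
and preserves `ψ`, hence preserves `B`. [cite: Milne1999LefschetzClasses, §1 pp. 642–644 and Prop. 4.8]
[cite: LangeBirkenhake1992, Lemma 1.1.17, Lemma 1.7.4 and Prop. 5.2.1] -/
theorem mem_unitaryCentralizerGroup_of_forall_form_eq_of_forall_comp_eq (hHD : exists_isReal_hodgeModel)
    (hI : hodgePQ_independent_of_hodgeModel) (hA0 : 0 < A.dim)
    (ψ : (BettiUniverse.hodge hHD (AbelianVariety.isSmoothProjective_holds (A := A)) 1).Polarization)
    (D : KaehlerRationalDatum A.dim A.X) {u : bettiCohomology A.X 1 ≃ₗ[ℚ] bettiCohomology A.X 1}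
    (hu : ∀ v w, ψ.form (u v) (u w) = ψ.form v w)
    (huc : ∀ a : (BettiUniverse.hodge hHD (AbelianVariety.isSmoothProjective_holds (A := A)) 1).endAlg,
      (u : bettiCohomology A.X 1 →ₗ[ℚ] bettiCohomology A.X 1) ∘ₗ (a : Module.End ℚ (bettiCohomology A.X 1)) =
        (a : Module.End ℚ (bettiCohomology A.X 1)) ∘ₗ (u : bettiCohomology A.X 1 →ₗ[ℚ] bettiCohomology A.X 1)) :
    ((ofRatClassBaseChangeEquiv (AbelianVariety.isSmoothProjective_holds (A := A)) 1).symm.trans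
        ((u.baseChange ℚ ℂ (bettiCohomology A.X 1) (bettiCohomology A.X 1)).trans
          (ofRatClassBaseChangeEquiv (AbelianVariety.isSmoothProjective_holds (A := A)) 1))) ∈
      unitaryCentralizerGroup A D.Hη := by
  classical
  haveI : Module.Finite ℚ (bettiCohomology A.X 1) := finite_bettiCohomology_one A
  haveI : Module.Finite ℂ (complexBetti A.X 1) := finite_complexBetti_abelianVariety A 1
  have hX : IsSmoothProjective A.dim A.X := AbelianVariety.isSmoothProjective_holds
  have hA : A.dim = (A.dim - 1) + 1 := (Nat.sub_add_cancel hA0).symm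
  have hX' : IsSmoothProjective (A.dim - 1 + 1) A.X := by rw [← hA]; exact hX
  set ρ := ofRatClassBaseChangeEquiv (AbelianVariety.isSmoothProjective_holds (A := A)) 1 with hρ
  set γ := u.baseChange ℚ ℂ (bettiCohomology A.X 1) (bettiCohomology A.X 1) with hγdef
  have hγapply : ∀ z, γ z = (u : bettiCohomology A.X 1 →ₗ[ℚ] bettiCohomology A.X 1).baseChange ℂ z := fun z => rfl
  -- commutation with the Hodge endomorphisms, complexified
  have hcommC : ∀ a : (BettiUniverse.hodge hHD (AbelianVariety.isSmoothProjective_holds (A := A)) 1).endAlg, ∀ z,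
      γ ((a : Module.End ℚ (bettiCohomology A.X 1)).baseChange ℂ z) =
        (a : Module.End ℚ (bettiCohomology A.X 1)).baseChange ℂ (γ z) := by
    intro a z
    rw [hγapply, hγapply, ← LinearMap.comp_apply, ← LinearMap.baseChange_comp, huc a, LinearMap.baseChange_comp,
      LinearMap.comp_apply]
  -- the datum
  have hQrat : IsRationalClass D.Hη := D.isRationalClass_Hη
  have hK1 : IsKaehlerClass A.dim A.X (((1 : ℝ) : ℂ) • D.Hη) := by
    rw [Complex.ofReal_one, one_smul]
    exact D.isKaehlerClassVia.isKaehlerClass D.isNatural D.isMultiplicative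
  have hnd := eq_zero_of_forall_polarizationPairingOne_eq_zero_of_isKaehlerClass_smul' one_ne_zero hK1
  have h11' : IsOfHodgeType (A.dim - 1 + 1) A.X 2 1 1 D.Hη := by rw [← hA]; exact D.isOfHodgeType_Hη
  have hU : ∀ x, (ρ.symm.trans (γ.trans ρ)) (ρ x) = ρ (γ x) := fun x => by
    simp only [LinearEquiv.trans_apply, LinearEquiv.symm_apply_apply]
  rw [mem_unitaryCentralizerGroup_iff]
  refine ⟨?_, ?_⟩
  · -- `u` commutes with every `φ^*`: the rational `φ^*` is a Hodge endomorphism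
    rw [mem_centralizerGroup_iff]
    intro φ a'
    obtain ⟨x, rfl⟩ := ρ.surjective a'
    have hmem : BettiUniverse.pull φ.hom.hom.hom 1 ∈
        (BettiUniverse.hodge hHD (AbelianVariety.isSmoothProjective_holds (A := A)) 1).endAlg :=
      fun p => BettiUniverse.pull_hodge hHD hI hX hX φ.hom.hom.hom 1 p
    have hpb : ∀ t, pullbackOne A φ (ρ t) = ρ ((BettiUniverse.pull φ.hom.hom.hom 1).baseChange ℂ t) := fun t =>
      complexBetti_map_ofRatClassBaseChangeEquiv hX hX φ.hom.hom.hom t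
    rw [hU, hpb, hU, hpb, hcommC ⟨_, hmem⟩]
  -- the scalar symplectic form `B = lam ∘ Q_h`
  obtain ⟨B, -, -, lam, hlam, hBapp⟩ := exists_bilinForm_isAlt_nondegenerate (A := A) hnd
  -- the rational line `H^{2 dim A}(A(ℂ); ℚ)`
  haveI : Module.Finite ℚ (bettiCohomology A.X (2 + 2 * (A.dim - 1))) := finiteDimensional_bettiCohomology hX _
  have hfrQ : Module.finrank ℚ (bettiCohomology A.X (2 + 2 * (A.dim - 1))) = 1 := by
    have h := (ofRatClassBaseChangeEquiv hX (2 + 2 * (A.dim - 1))).finrank_eq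
    rwa [Module.finrank_baseChange, Motives.finrank_complexBetti_two_add_two_mul_eq_one hX'] at h
  set b1 := Module.finBasisOfFinrankEq ℚ (bettiCohomology A.X (2 + 2 * (A.dim - 1))) hfrQ with hb1
  set τ : bettiCohomology A.X (2 + 2 * (A.dim - 1)) →ₗ[ℚ] ℚ := b1.coord 0 with hτdef
  have hτ : ∀ r, r = τ r • b1 0 := fun r => by
    conv_lhs => rw [← b1.sum_repr r, Fin.sum_univ_one]
    rfl
  have hω0 : ofRatClass (ComplexPoints A.X) _ (b1 0) ≠ 0 := fun h0 =>
    b1.ne_zero 0 (ofRatClass_injective _ (by rw [h0, map_zero]))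
  have hlamω : lam (ofRatClass (ComplexPoints A.X) _ (b1 0)) ≠ 0 := fun h0 => hω0 (hlam (by rw [h0, map_zero]))
  -- the rational form `B_ℚ = τ ∘ Q_η`
  set Qℚ : bettiCohomology A.X 1 →ₗ[ℚ] bettiCohomology A.X 1 →ₗ[ℚ] bettiCohomology A.X (2 + 2 * (A.dim - 1)) :=
    (cupProduct (R := ℚ) (X := ComplexPoints A.X) (rfl : 1 + 1 = 2)).compr₂ (lefschetzPow D.η (A.dim - 1) 2) with hQℚ
  set Bℚ : LinearMap.BilinForm ℚ (bettiCohomology A.X 1) := Qℚ.compr₂ τ with hBℚ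
  have hQℚof : ∀ v w, ofRatClass (ComplexPoints A.X) _ (Qℚ v w) =
      Motives.polarizationPairingOne A.X D.Hη (A.dim - 1) (ofRatClass _ 1 v) (ofRatClass _ 1 w) := by
    intro v w
    simp only [hQℚ, LinearMap.compr₂_apply, Motives.polarizationPairingOne_apply]
    rw [D.ofRatClass_lefschetzPow, ofRatClass_eq_ringChange, singularCohomology.ringChange_cupProduct,
      ← ofRatClass_eq_ringChange, ← ofRatClass_eq_ringChange]
  have hKEY : ∀ v w, B (ofRatClass _ 1 v) (ofRatClass _ 1 w) =
      (Bℚ v w : ℂ) * lam (ofRatClass (ComplexPoints A.X) _ (b1 0)) := by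
    intro v w
    rw [hBapp, ← hQℚof, hτ (Qℚ v w), ofRatClass_rat_smul_trf, map_smul, smul_eq_mul]
    simp only [hBℚ, LinearMap.compr₂_apply]
  have hKEYC : ∀ x y, B (ρ x) (ρ y) = lam (ofRatClass (ComplexPoints A.X) _ (b1 0)) * Bℚ.baseChange ℂ x y := by
    intro x y
    induction x using TensorProduct.induction_on with
    | zero => simp
    | add x₁ x₂ h₁ h₂ => simp only [map_add, LinearMap.add_apply, h₁, h₂, mul_add]
    | tmul c v =>
      induction y using TensorProduct.induction_on with
      | zero => simp
      | add y₁ y₂ h₁ h₂ => simp only [map_add, h₁, h₂, mul_add]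
      | tmul d w =>
        rw [hρ, ofRatClassBaseChangeEquiv_apply, ofRatClassBaseChangeEquiv_apply, ofRatClassBaseChange_tmul,
          ofRatClassBaseChange_tmul]
        simp only [map_smul, LinearMap.smul_apply, smul_eq_mul]
        rw [hKEY, LinearMap.BilinForm.baseChange_tmul, Algebra.smul_def, eq_ratCast]
        ring
  -- the comparison endomorphism `a`: `ψ(a v, w) = B_ℚ(v, w)`
  set a : Module.End ℚ (bettiCohomology A.X 1) := (ψ.toDualEquiv.symm : _ →ₗ[ℚ] _) ∘ₗ Bℚ with hadef
  have ha_form : ∀ v w, ψ.form (a v) w = Bℚ v w := fun v w => by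
    simp only [hadef, LinearMap.comp_apply, LinearEquiv.coe_coe, Polarization.form_toDualEquiv_symm]
  have ha_formC : ∀ x y, ψ.form.baseChange ℂ (a.baseChange ℂ x) y = Bℚ.baseChange ℂ x y := by
    intro x y
    induction x using TensorProduct.induction_on with
    | zero => simp
    | add x₁ x₂ h₁ h₂ => simp only [map_add, LinearMap.add_apply, h₁, h₂]
    | tmul c v =>
      induction y using TensorProduct.induction_on with
      | zero => simp
      | add y₁ y₂ h₁ h₂ => simp only [map_add, h₁, h₂]
      | tmul d w =>
        rw [LinearMap.baseChange_tmul, LinearMap.BilinForm.baseChange_tmul, LinearMap.BilinForm.baseChange_tmul, ha_form]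
  -- `a ∈ End_Hdg(H¹)`: it preserves `F¹`
  have heff := BettiUniverse.hodge_isEffective hHD hX 1
  have hF0 : (BettiUniverse.hodge hHD hX 1).F 0 = ⊤ := by
    rw [BettiUniverse.hodge_F]; exact HodgeModel.ratF_of_nonpos _ _ 1 le_rfl
  have hF1 : ∀ x ∈ (BettiUniverse.hodge hHD hX 1).F 1, ρ x ∈ hodgeOneZero hX' := by
    intro x hx
    have hx' : x ∈ (BettiUniverse.hodge hHD hX 1).piece 1 0 := by
      rw [piece_of_add_eq _ (by norm_num : (1 : ℤ) + 0 = ((1 : ℕ) : ℤ)), hF0, complexConj_top]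
      exact ⟨hx, Submodule.mem_top⟩
    have h := (BettiUniverse.mem_hodge_piece_iff hHD hI hX (k := 1) (p := 1) (q := 0) rfl x).1 hx'
    rw [mem_hodgeOneZero, ← hA]
    exact h
  have ha : a ∈ (BettiUniverse.hodge hHD hX 1).endAlg := by
    rw [mem_endAlg_iff]
    intro p
    rcases le_or_gt p 0 with hp | hp
    · rw [BettiUniverse.hodge_F, HodgeModel.ratF_of_nonpos _ _ 1 hp]
      exact le_top
    rcases le_or_gt p 1 with hp1 | hp1
    · obtain rfl : p = 1 := le_antisymm hp1 (by omega)
      rw [Submodule.map_le_iff_le_comap]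
      intro x hx
      refine ψ.mem_F_one_of_forall_form_eq_zero Nat.cast_one heff fun y hy => ?_
      have hiso : Motives.polarizationPairingOne A.X D.Hη (A.dim - 1) (ρ x) (ρ y) = 0 :=
        polarizationPairingOne_eq_zero_of_mem_hodgeOneZero hX' h11' (hF1 x hx) (hF1 y hy)
      have h := hKEYC x y
      rw [hBapp, hiso, map_zero] at h
      rw [ha_formC]
      exact (mul_eq_zero.1 h.symm).resolve_left hlamω
    · have hp2 : (((1 : ℕ) : ℤ)) < p := by push_cast; omega
      rw [BettiUniverse.hodge_F, HodgeModel.ratF_eq_bot _ _ 1 hp2, Submodule.map_bot]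
  -- `ψ_ℂ` is `u_ℂ`-invariant, hence so is `B_ℚ ⊗ ℂ = ψ_ℂ(a_ℂ ·, ·)` (`u` commutes with `a`)
  have hγψ : ∀ x y, ψ.form.baseChange ℂ (γ x) (γ y) = ψ.form.baseChange ℂ x y := by
    intro x y
    induction x using TensorProduct.induction_on with
    | zero => simp
    | add x₁ x₂ h₁ h₂ => simp only [map_add, LinearMap.add_apply, h₁, h₂]
    | tmul c' v =>
      induction y using TensorProduct.induction_on with
      | zero => simp
      | add y₁ y₂ h₁ h₂ => simp only [map_add, h₁, h₂]
      | tmul d w =>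
        rw [hγdef, LinearEquiv.baseChange_tmul, LinearEquiv.baseChange_tmul, LinearMap.BilinForm.baseChange_tmul,
          LinearMap.BilinForm.baseChange_tmul, hu]
  have hγB : ∀ x y, Bℚ.baseChange ℂ (γ x) (γ y) = Bℚ.baseChange ℂ x y := fun x y => by
    rw [← ha_formC, ← ha_formC, ← hcommC ⟨a, ha⟩, hγψ]
  -- conclusion
  intro a' b'
  obtain ⟨x, rfl⟩ := ρ.surjective a'
  obtain ⟨y, rfl⟩ := ρ.surjective b'
  apply hlam
  rw [← hBapp, ← hBapp, hU, hU, hKEYC, hKEYC, hγB]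

end Bridge

/-! ### §3 `Lie Hg(H¹A) = 𝔰𝔭_F(H¹(A;ℚ), ψ)` and `Lie Hg(H¹A) ⊗ ℂ = ⊕_τ 𝔰𝔭(V_τ)` for a stably nondegenerate `A` with
`End⁰(A) = F` a totally real field -/

section Headline

variable [HodgeTensorFacts.{0, 0}] {A : AbelianVariety ℂ} (hF : IsField A.endAlgebra)

open Literature.AlgebraicGeometry.VanGeemen1994 (hodgeClassSpan)
open Literature.Geometry.Kaehler (lefschetzPow)

/-- **MILNE'S PROP. 4.8 (a) ⇒ (c) / MOONEN–ZARHIN (1.8) ⟸ for `End⁰(A)` a totally real FIELD `F`, Lie form over `ℚ`: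
`𝔰𝔭_F(H¹(A;ℚ), ψ) ⊆ Lie Hg(H¹A)`.** If NO POWER of the complex abelian variety `A` supports an exotic Hodge class
(`IsStablyNondegenerate A`) and `End⁰(A) = F` is a totally real field, then every `F`-LINEAR `ψ`-skew rational operator of
`H¹(A(ℂ); ℚ)` lies in `Lie Hg(H¹A)`, for every polarization `ψ`. (Milne Prop. 4.8: «(a) no power of `A` supports an exotic
Hodge class … (c) `Hg′(A) = S(A)`», `S(A)` = the centraliser of `End⁰(A)` in `Sp`, §1 p. 644 — here `R_{F/ℚ} Sp_{F}(H¹, ψ_F)`;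
MZ99 (1.8): «`Hg(X) = Sp_D(V, φ)` ⟺ … `D(Xⁿ) = B(Xⁿ)` for all `n`», type I with `D = F`.)  PROOF: `𝔰𝔭_F` is spanned by the
`F`-transvections `e·N_v` (§1), which are square-zero, `ψ`-skew and `F`-linear; by the Rosati-triviality of `F`
(`isAdjointPair_self_of_isTotallyReal`) and Riemann (`mem_endAlg_hodge_one_iff`) they commute with `End_Hdg(H¹)`, so their
exponentials lie in `S(A)(ℂ)` (§2), and the tree's `mem_hodgeLie_of_isStablyNondegenerate_of_transvection_mem_unitaryCentralizerGroup`
(Milne 4.8 with Thm. 4.4 and Deligne's criterion) puts them in `Lie Hg`.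
[cite: Milne1999LefschetzClasses, Prop. 4.8 (p. 660), Thm. 4.4 and §1 p. 644] [cite: MoonenZarhin1999LowDim, §1 (1.8)]
[cite: Hazama1983, §3 (pp. 305–306)] -/
theorem mem_hodgeLie_of_commute_of_skew_of_isStablyNondegenerate_of_isField (hHD : exists_isReal_hodgeModel)
    (hI : hodgePQ_independent_of_hodgeModel) [IsTotallyReal (EndField A hF)] (hD : IsStablyNondegenerate A)
    (hA0 : 0 < A.dim)
    (ψ : (BettiUniverse.hodge hHD (AbelianVariety.isSmoothProjective_holds (A := A)) 1).Polarization)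
    {X : Module.End ℚ (bettiCohomology A.X 1)}
    (hXc : ∀ a : (BettiUniverse.hodge hHD (AbelianVariety.isSmoothProjective_holds (A := A)) 1).endAlg,
      X * (a : Module.End ℚ (bettiCohomology A.X 1)) = (a : Module.End ℚ (bettiCohomology A.X 1)) * X)
    (hX : ∀ v w, ψ.form (X v) w + ψ.form v (X w) = 0) :
    X ∈ (BettiUniverse.hodge hHD (AbelianVariety.isSmoothProjective_holds (A := A)) 1).hodgeLie := by
  classical
  haveI : Module.Finite ℚ (bettiCohomology A.X 1) := finite_bettiCohomology_one A
  have hn : Odd (((1 : ℕ) : ℤ)) := ⟨0, by norm_num⟩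
  have hXs : IsSmoothProjective A.dim A.X := AbelianVariety.isSmoothProjective_holds
  obtain ⟨D⟩ := nonempty_kaehlerRationalDatum hXs
  set Act := hOneEndAction (EndField.toEndAlgebra hF).toRingHom hHD hI (A := A) with hAct
  have hself : ∀ e : EndField A hF, LinearMap.IsAdjointPair ψ.form ψ.form (Act.ι e) (Act.ι e) := fun e =>
    isAdjointPair_self_of_isTotallyReal hF hHD hI hA0 ψ (endFieldAlgEquivEndAlg hF hHD hI e)
  -- every Hodge endomorphism is some `e^*`
  have hcommE : ∀ {N : Module.End ℚ (bettiCohomology A.X 1)}, EndAction.IsEquivariant Act Act N →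
      ∀ a : (BettiUniverse.hodge hHD (AbelianVariety.isSmoothProjective_holds (A := A)) 1).endAlg,
        N ∘ₗ (a : Module.End ℚ (bettiCohomology A.X 1)) = (a : Module.End ℚ (bettiCohomology A.X 1)) ∘ₗ N := by
    intro N hN a
    obtain ⟨e, he⟩ := (mem_endAlg_hodge_one_iff hF hHD hI (a : Module.End ℚ (bettiCohomology A.X 1))).1 a.2
    rw [← he]
    exact hN e
  -- the `F`-transvections lie in `Lie Hg`
  have hT : ∀ v : bettiCohomology A.X 1, EndAction.average Act Act ((ψ.form v).smulRight v) ∈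
      (BettiUniverse.hodge hHD (AbelianVariety.isSmoothProjective_holds (A := A)) 1).hodgeLie := by
    intro v
    have hN2 := EndAction.average_smulRight_self_mul_self ψ Act hn hself v
    have hNil : IsNilpotent (EndAction.average Act Act ((ψ.form v).smulRight v)) := ⟨2, by rw [pow_two, hN2]⟩
    have hskew := EndAction.average_smulRight_self_skew ψ Act hn hself v
    have heqv := EndAction.isEquivariant_average Act Act ((ψ.form v).smulRight v)
    refine mem_hodgeLie_of_isStablyNondegenerate_of_transvection_mem_unitaryCentralizerGroup hHD hI hD hA0 ψ D hNil
      hskew (mem_unitaryCentralizerGroup_of_forall_form_eq_of_forall_comp_eq hHD hI hA0 ψ D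
        (form_unipotentOfNilpotent_of_mul_self_eq_zero ψ hNil hN2 hskew) fun a => ?_)
    have hexp : ∀ x, Motives.unipotentOfNilpotent hNil x = x + EndAction.average Act Act ((ψ.form v).smulRight v) x := by
      intro x
      rw [← LinearEquiv.coe_coe, Motives.coe_unipotentOfNilpotent, IsNilpotent.exp_eq_sum (k := 2) (by rw [pow_two, hN2])]
      simp [Finset.sum_range_succ]
    refine LinearMap.ext fun x => ?_
    rw [LinearMap.comp_apply, LinearMap.comp_apply, LinearEquiv.coe_coe, hexp, hexp, map_add, ← LinearMap.comp_apply,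
      hcommE heqv a, LinearMap.comp_apply]
  -- `𝔰𝔭_F` is spanned by them
  refine ψ.mem_of_isEquivariant_of_skew_of_forall_average_mem Act hn _ hT (fun e => ?_) hX
  rw [← Module.End.mul_eq_comp, ← Module.End.mul_eq_comp]
  exact hXc (endFieldAlgEquivEndAlg hF hHD hI e)

/-- **`Lie Hg(H¹A) = 𝔰𝔭_F(H¹(A;ℚ), ψ)` as an equivalence** for a stably nondegenerate `A` of positive dimension with
`End⁰(A) = F` a totally real field: a rational operator lies in `Lie Hg` iff it commutes with every Hodge endomorphism
(`= e^*`, `e ∈ F`, by Riemann) and is `ψ`-skew (`→` holds for every abelian variety: `commute_of_mem_hodgeLie`,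
`form_apply_add_eq_zero_of_mem_hodgeLie`). [cite: Milne1999LefschetzClasses, Prop. 4.8 (p. 660) and §1 p. 644]
[cite: MoonenZarhin1999LowDim, §1 (1.8)] -/
theorem mem_hodgeLie_iff_commute_and_skew_of_isStablyNondegenerate_of_isField (hHD : exists_isReal_hodgeModel)
    (hI : hodgePQ_independent_of_hodgeModel) [IsTotallyReal (EndField A hF)] (hD : IsStablyNondegenerate A)
    (hA0 : 0 < A.dim)
    (ψ : (BettiUniverse.hodge hHD (AbelianVariety.isSmoothProjective_holds (A := A)) 1).Polarization)
    (X : Module.End ℚ (bettiCohomology A.X 1)) :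
    X ∈ (BettiUniverse.hodge hHD (AbelianVariety.isSmoothProjective_holds (A := A)) 1).hodgeLie ↔
      (∀ a : (BettiUniverse.hodge hHD (AbelianVariety.isSmoothProjective_holds (A := A)) 1).endAlg,
        X * (a : Module.End ℚ (bettiCohomology A.X 1)) = (a : Module.End ℚ (bettiCohomology A.X 1)) * X) ∧
      (∀ v w, ψ.form (X v) w + ψ.form v (X w) = 0) := by
  haveI : Module.Finite ℚ (bettiCohomology A.X 1) := finite_bettiCohomology_one A
  refine ⟨fun hX => ⟨fun a => (BettiUniverse.hodge hHD _ 1).commute_of_mem_hodgeLie hX a,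
    fun v w => form_apply_add_eq_zero_of_mem_hodgeLie ψ hX v w⟩, fun ⟨hXc, hX⟩ => ?_⟩
  exact mem_hodgeLie_of_commute_of_skew_of_isStablyNondegenerate_of_isField hF hHD hI hD hA0 ψ hXc hX

/-- **The same over `ℂ`: `Lie Hg(H¹A) ⊗ ℂ ⊇ 𝔰𝔭_{F ⊗ ℂ}(H¹(A;ℚ) ⊗ ℂ, ψ_ℂ)`** — every `ψ_ℂ`-skew operator commuting with
`End_Hdg(H¹) ⊗ ℂ` lies in the complexified Hodge Lie algebra (descent of commutants, `Polarization.mem_spanC_of_commute_of_skew`).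
[cite: Milne1999LefschetzClasses, Prop. 4.8 (p. 660)] [cite: MoonenZarhin1999LowDim, §1 (1.8)]
[cite: Deligne1982HodgeCycles, I §3 (proof of Prop. 3.4)] -/
theorem mem_hodgeLieC_of_commute_of_skew_of_isStablyNondegenerate_of_isField (hHD : exists_isReal_hodgeModel)
    (hI : hodgePQ_independent_of_hodgeModel) [IsTotallyReal (EndField A hF)] (hD : IsStablyNondegenerate A)
    (hA0 : 0 < A.dim)
    (ψ : (BettiUniverse.hodge hHD (AbelianVariety.isSmoothProjective_holds (A := A)) 1).Polarization)
    {Y : Module.End ℂ (ℂ ⊗[ℚ] bettiCohomology A.X 1)}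
    (hYc : ∀ a : (BettiUniverse.hodge hHD (AbelianVariety.isSmoothProjective_holds (A := A)) 1).endAlg,
      Y * (a : Module.End ℚ (bettiCohomology A.X 1)).baseChange ℂ = (a : Module.End ℚ (bettiCohomology A.X 1)).baseChange ℂ * Y)
    (hY : ∀ x y, ψ.form.baseChange ℂ (Y x) y + ψ.form.baseChange ℂ x (Y y) = 0) :
    Y ∈ (BettiUniverse.hodge hHD (AbelianVariety.isSmoothProjective_holds (A := A)) 1).hodgeLieC := by
  haveI : Module.Finite ℚ (bettiCohomology A.X 1) := finite_bettiCohomology_one A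
  rw [hodgeLieC_eq_spanC]
  exact ψ.mem_spanC_of_commute_of_skew _
    (fun X hXc hX => mem_hodgeLie_of_commute_of_skew_of_isStablyNondegenerate_of_isField hF hHD hI hD hA0 ψ hXc hX) hYc hY

/-- **Block form — the hypothesis (RIGID BLOCKS) of the tree's `Motives/HodgeThetaAnnihilatorTimesRigidBlocks`**: for a
stably nondegenerate `A` with `End⁰(A) = F` a totally real field, every operator of `H¹(A;ℚ) ⊗ ℂ` preserving the joint
eigenspaces `V_τ` (`τ : F → ℂ`) of `F` and skew for `ψ_ℂ` lies in `Lie Hg(H¹A) ⊗ ℂ`: `Lie Hg(H¹A) ⊗ ℂ = ⊕_τ 𝔰𝔭(V_τ, ψ_ℂ)`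
(«`hg = 𝔰𝔭 × ⋯ × 𝔰𝔭`», Hazama's type (1) with all places; the converse inclusion holds for every `A`,
`apply_mem_eigenBlock_of_mem_hodgeLieC`, `formBaseChange_skew_of_mem_hodgeLieC`).
[cite: Milne1999LefschetzClasses, Prop. 4.8 (p. 660) and §1 p. 644] [cite: Hazama1983, §3 (pp. 305–306)]
[cite: MoonenZarhin1999LowDim, §1 (1.8) and §2 (2.1)] -/
theorem mem_hodgeLieC_of_mapsTo_of_skew_of_isStablyNondegenerate_of_isField (hHD : exists_isReal_hodgeModel)
    (hI : hodgePQ_independent_of_hodgeModel) [IsTotallyReal (EndField A hF)] (hD : IsStablyNondegenerate A)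
    (hA0 : 0 < A.dim)
    (ψ : (BettiUniverse.hodge hHD (AbelianVariety.isSmoothProjective_holds (A := A)) 1).Polarization)
    {Y : Module.End ℂ (ℂ ⊗[ℚ] bettiCohomology A.X 1)}
    (hYT : ∀ τ : EndField A hF →+* ℂ, Set.MapsTo Y
      ((BettiUniverse.hodge hHD (AbelianVariety.isSmoothProjective_holds (A := A)) 1).eigenBlock (hodgeCharacter hF hHD hI τ))
      ((BettiUniverse.hodge hHD (AbelianVariety.isSmoothProjective_holds (A := A)) 1).eigenBlock (hodgeCharacter hF hHD hI τ)))
    (hY : ∀ x y, ψ.form.baseChange ℂ (Y x) y + ψ.form.baseChange ℂ x (Y y) = 0) :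
    Y ∈ (BettiUniverse.hodge hHD (AbelianVariety.isSmoothProjective_holds (A := A)) 1).hodgeLieC := by
  classical
  haveI : Module.Finite ℚ (bettiCohomology A.X 1) := finite_bettiCohomology_one A
  exact mem_hodgeLieC_of_commute_of_skew_of_isStablyNondegenerate_of_isField hF hHD hI hD hA0 ψ
    (commute_of_mapsTo_eigenBlock _ (hodgeCharacter hF hHD hI) (isInternal_eigenBlock_hodgeCharacter hF hHD hI) hYT) hY

end Headline

end Literature.AlgebraicGeometry.HodgeTheory

end
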